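import Mathlib
import HarnessLib

/-!
# Crux `IR` (stmt-QuantumFields-19354) — the DOMINATION ENGINE `DominationEngine` (stub S3 of the withdrawn line
# `defect-chain-price`, ym-ir-idea-3) PROVED: hereditary `p`-domination prices an annealed factor `t` per bad box by `e^{(t−1)pm}`

Helper module for item `stmt-QuantumFields-19354` (`--supports … --as helper`; it closes nothing).  Pure probability, group- and
`β`-blind.  The ideator's line `defect-chain-price` (`Cruxes/IR/Lines/defect_chain_price.lean`) was STRUCK as typed (its load S2 is
crux-equivalent) and withdrawn, with the recommendation «no mechanism; bank the engine» (idea-3 → director, 2026-08-27T23:59:58Z).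
This file banks the engine S3 VERBATIM (body unfolded, no new definitions), so that `stub_dominationEngine : DominationEngine` closes by
`exact dominationEngine_holds`:

* `dominationEngine_holds` — for a probability measure `μ`, sets `bad 0, …, bad (m−1)` that are HEREDITARILY `p`-DOMINATED
  (`μ{ω | ∀ j ∈ F, ω ∈ bad j} ≤ p^{#F}` for every `F ⊆ range m`, `0 ≤ p`) and a price `t ≥ 1`,
  `∫ t^{#{j < m : ω ∈ bad j}} dμ ≤ exp((t − 1)·p·m)`.

Proof (textbook; e.g. Liggett–Schonmann–Stacey, *Domination by product measures*, Ann. Probab. 25 (1997), the counting step; here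
elementary): the binomial identity over the powerset `t^{#S} = Σ_{F ⊆ S} (t−1)^{#F}` (Mathlib `Finset.sum_pow_mul_eq_add_pow`) writes the
integrand as `Σ_{F ⊆ range m} (t−1)^{#F}·1_{A_F}` with `A_F = {∀ j ∈ F, · ∈ bad j}`; NO measurability is assumed, so each `A_F` is replaced
by its measurable hull `toMeasurable μ A_F ⊇ A_F` (same measure), which can only increase the integrand; the hull sum is integrable, so
`integral_mono_of_nonneg` applies (the left integral being the junk value `0` if the integrand is not integrable); integrating gives
`Σ_F ((t−1)p)^{#F} = (1 + (t−1)p)^m ≤ e^{(t−1)pm}`.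

HONEST FRAMING.  A counting lemma; nothing here bears on `BalabanLadder.IR`, confinement, a lattice gap or the Yang–Mills mass gap (Clay),
which are NOT proved; `R4` closes only the conditional finite-𝕋⁴ rung `BalabanLadder.UV`.
-/

set_option autoImplicit false

noncomputable section

open MeasureTheory Finset

namespace Summit.QuantumFields.YangMills.Cruxes.IR.DefectChainPrice

/-- The binomial identity over the powerset: `Σ_{F ⊆ S} a^{#F} = (a + 1)^{#S}`. [folklore] -/
theorem sum_powerset_pow_card {ι : Type*} (S : Finset ι) (a : ℝ) :
    ∑ F ∈ S.powerset, a ^ F.card = (a + 1) ^ S.card := by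
  rw [← Finset.sum_pow_mul_eq_add_pow a 1 S]
  refine Finset.sum_congr rfl fun F _ => ?_
  rw [one_pow, mul_one]

open Classical in
/-- **S3 — the domination engine (`DominationEngine`, verbatim).**  If `bad 0, …, bad (m−1)` are hereditarily `p`-dominated under a
probability measure `μ` (`μ{∀ j ∈ F, · ∈ bad j} ≤ p^{#F}` for all `F ⊆ range m`, `0 ≤ p`), then for every price `t ≥ 1`,
`∫ t^{#{j<m : ω ∈ bad j}} dμ ≤ exp((t−1) p m)`.  No measurability hypothesis (measurable hulls; junk integral `0` otherwise). -/
theorem dominationEngine_holds :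
    ∀ (Ω : Type) [MeasurableSpace Ω] (μ : Measure Ω) [IsProbabilityMeasure μ] (bad : ℕ → Set Ω) (m : ℕ) (p t : ℝ),
      0 ≤ p → 1 ≤ t →
      (∀ F ⊆ Finset.range m, μ.real {ω | ∀ j ∈ F, ω ∈ bad j} ≤ p ^ F.card) →
      (∫ ω, t ^ ((Finset.range m).filter fun j => ω ∈ bad j).card ∂μ) ≤ Real.exp ((t - 1) * p * m) := by
  intro Ω _ μ _ bad m p t hp ht hdom
  -- notation: the sub-events and their measurable hulls
  set A : Finset ℕ → Set Ω := fun F => {ω | ∀ j ∈ F, ω ∈ bad j} with hA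
  set T : Finset ℕ → Set Ω := fun F => toMeasurable μ (A F) with hT
  have hT_meas : ∀ F, MeasurableSet (T F) := fun F => measurableSet_toMeasurable μ (A F)
  have hAT : ∀ F, A F ⊆ T F := fun F => subset_toMeasurable μ (A F)
  have hT_real : ∀ F, μ.real (T F) = μ.real (A F) := fun F => by
    simp only [hT, Measure.real, measure_toMeasurable]
  have ht1 : 0 ≤ t - 1 := by linarith
  -- the hull majorant
  set g : Ω → ℝ := fun ω => ∑ F ∈ (Finset.range m).powerset, (T F).indicator (fun _ => (t - 1) ^ F.card) ω with hg
  -- pointwise: the integrand is the powerset sum over the bad set, dominated by `g`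
  have hpt : ∀ ω, t ^ ((Finset.range m).filter fun j => ω ∈ bad j).card ≤ g ω := by
    intro ω
    set S : Finset ℕ := (Finset.range m).filter fun j => ω ∈ bad j with hS
    have hSR : S ⊆ Finset.range m := Finset.filter_subset _ _
    have hexp : t ^ S.card = ∑ F ∈ S.powerset, (t - 1) ^ F.card := by
      rw [sum_powerset_pow_card, sub_add_cancel]
    have hωA : ∀ F ∈ S.powerset, ω ∈ A F := by
      intro F hF j hj
      have hjS : j ∈ S := Finset.mem_powerset.1 hF hj
      rw [hS, Finset.mem_filter] at hjS
      exact hjS.2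
    rw [hexp, hg]
    calc ∑ F ∈ S.powerset, (t - 1) ^ F.card
        = ∑ F ∈ S.powerset, (T F).indicator (fun _ => (t - 1) ^ F.card) ω :=
          Finset.sum_congr rfl fun F hF => by rw [Set.indicator_of_mem (hAT F (hωA F hF))]
      _ ≤ ∑ F ∈ (Finset.range m).powerset, (T F).indicator (fun _ => (t - 1) ^ F.card) ω :=
          Finset.sum_le_sum_of_subset_of_nonneg (Finset.powerset_mono.2 hSR)
            fun F _ _ => Set.indicator_nonneg (fun _ _ => pow_nonneg ht1 _) ω
  -- `g` is integrable and its integral is the priced sum of the hull measures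
  have hg_int : Integrable g μ := by
    refine integrable_finsetSum _ fun F _ => ?_
    exact (integrable_const ((t - 1) ^ F.card)).indicator (hT_meas F)
  have hg_integral : ∫ ω, g ω ∂μ = ∑ F ∈ (Finset.range m).powerset, (t - 1) ^ F.card * μ.real (A F) := by
    rw [hg, integral_finsetSum _ fun F _ => (integrable_const ((t - 1) ^ F.card)).indicator (hT_meas F)]
    refine Finset.sum_congr rfl fun F _ => ?_
    rw [integral_indicator_const _ (hT_meas F), hT_real F, smul_eq_mul, mul_comm]
  -- compare the integrals (no integrability of the left-hand side is needed)
  have hmono : (∫ ω, t ^ ((Finset.range m).filter fun j => ω ∈ bad j).card ∂μ) ≤ ∫ ω, g ω ∂μ :=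
    integral_mono_of_nonneg (Filter.Eventually.of_forall fun ω => pow_nonneg (by linarith) _) hg_int
      (Filter.Eventually.of_forall hpt)
  -- price the sum by domination and sum the binomial
  have hsum : ∑ F ∈ (Finset.range m).powerset, (t - 1) ^ F.card * μ.real (A F) ≤ Real.exp ((t - 1) * p * m) := by
    calc ∑ F ∈ (Finset.range m).powerset, (t - 1) ^ F.card * μ.real (A F)
        ≤ ∑ F ∈ (Finset.range m).powerset, ((t - 1) * p) ^ F.card := by
          refine Finset.sum_le_sum fun F hF => ?_
          rw [mul_pow]
          exact mul_le_mul_of_nonneg_left (hdom F (Finset.mem_powerset.1 hF)) (pow_nonneg ht1 _)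
      _ = ((t - 1) * p + 1) ^ m := by rw [sum_powerset_pow_card, Finset.card_range]
      _ ≤ (Real.exp ((t - 1) * p)) ^ m :=
          pow_le_pow_left₀ (by nlinarith [mul_nonneg ht1 hp]) (Real.add_one_le_exp _) m
      _ = Real.exp ((t - 1) * p * m) := by rw [← Real.exp_nat_mul]; ring_nf
  exact hmono.trans (hg_integral ▸ hsum)

end Summit.QuantumFields.YangMills.Cruxes.IR.DefectChainPrice

end
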